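/-
Copyright (c) 2026. All rights reserved.
Released under Apache 2.0 license as described in the file LICENSE.
Authors: abc-iut cell, campaign-S prover seat abc-iut-S8 (wave 2).
-/
import Mathlib.RingTheory.IntegralClosure.IsIntegralClosure.Basic
import Mathlib.Algebra.Algebra.Pi
import Literature.IUT.LogVolume.TensorPacketRing
import Literature.IUT.LogVolume.IntegerRingFinite
import Literature.IUT.LogVolume.PacketVolume
import Literature.IUT.LogVolume.LocalFieldEmbeddings
import HarnessLib

/-!
# The log-volume on the tensor packet `⊗_{ℚ_p} k_i` ([IUTchIV] Prop. 1.4 (i), tensor-product half)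

Mochizuki, *Inter-universal Teichmüller theory IV*, RIMS manuscript (Apr. 2020; = PRIMS **57** (2021)),
§1, Proposition 1.4 (i), kurims p. 13, second sentence: "Moreover, by applying the fact that tensor
products of finitely many finite extensions of `ℚ_p` over `ℤ_p` decompose, naturally, as direct sums of
finitely many finite extensions of `ℚ_p`, we obtain a notion of log-volume — which, by abuse of
notation, we shall also denote by "`μ^log(−)`" — defined on compact open subsets of such tensor
products, valued in `ℝ`, and normalized so that `μ^log((R_E)^∼) = 0`, `μ^log(p·(R_E)^∼) = −log(p)`, for
any nonempty set `E ⊆ I`."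

## What this file does

(The pure-tensor / integrality helpers below are `private`: their public versions belong to the
Prop. 1.1/1.2 companion files of abc-iut-S5/S6 — `PacketBases.purePacket_eq_prod_iota`,
`mem_normalizedPacket_iff_isIntegral`, `TensorPacketLemmas.algebraMap_mem_integerPacket` — which land
independently; nothing here depends on them.)

The packet objects are those of `TensorPacketRing.lean` (abc-iut-S1): `V = PacketAlgebra p k =
⊗_{ℚ_p, i∈I} k_i`, `ι_i`, pure tensors, `R_I = integerPacket`, `(R_I)^∼ = normalizedPacket`,
`log_p(R_I^×) = logPacket`, `p^n = ppow n`.  The "decomposition as a direct sum of finite extensions"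
is taken as a PARAMETER: a `ℚ_p`-algebra isomorphism `ψ : V ≃ₐ[ℚ_p] Π_{j∈J} L_j` onto a finite product of
fields `L_j` of the cell's norm-side MLF class (existence: `Literature.RingTheory.Etale.
piTensorProduct_fields_exists_algEquiv_pi_field_of_charZero`, abc-iut-L6-t5, plus the unique norms on
the factors).  Along `ψ` the volumes of `PacketVolume.lean` (abc-iut-S2: the `∏_j O_{L_j}`-normalised
Haar measure on `⊕_j L_j`, weight "the degree") are pulled back:

* `packetDegree p L = D := Σ_j e_j·f_j` (`= Σ_j [L_j:ℚ_p] = dim_{ℚ_p} V`) and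
  **`packetLogVolume ψ A := μ^log(A) = (1/D)·log μ_{∏ O_{L_j}}(ψ(A))`** for `A ⊆ V`;
* `mem_normalizedPacket_iff_isIntegral` — `(R_I)^∼` is the set of `ℤ_p`-integral elements of `V`
  (`R_I` is generated by integral elements); hence **`image_normalizedPacket`: `ψ((R_I)^∼) = ∏_j O_{L_j}`**
  (integrality is componentwise, `isIntegral_pi_iff`, and `O_{L_j}` = `ℤ_p`-integral elements of `L_j`,
  `norm_le_one_iff_isIntegral`, abc-iut-S1);
* the NORMALISATIONS as printed: **`packetLogVolume_normalizedPacket`: `μ^log((R_I)^∼) = 0`** and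
  **`packetLogVolume_natCast_smul_normalizedPacket`: `μ^log(p·(R_I)^∼) = −log(p)`**;
* the factor-by-factor rule behind the proof of Prop. 1.4 (iii) (p. 14):
  `packetLogVolume_smul_normalizedPacket` — for `g ∈ V` with all components `ψ(g)_j ≠ 0`,
  `μ^log(g·(R_I)^∼) = (1/D)·Σ_j e_j f_j·log ‖ψ(g)_j‖`, and, since every embedding `k_i → L_j` is an
  isometry (`LocalFieldEmbeddings.lean`), `packetLogVolume_ppow_mul_purePacket_smul`:
  `μ^log(p^n·(⊗_i h_i)·(R_I)^∼) = −n·log(p) + Σ_i log ‖h_i‖`.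
The sets `p^λ·(R_I)^∼` of Props. 1.1–1.4 are exactly such translates (`TensorPacketRing.lean` realises
"`p^λ`" as `p^n·(⊗ h_i)`), so their log-volumes are now explicit numbers; the ESTIMATES of Prop. 1.4
(iii)/(iv) are the sequel file.  Deliberately NOT here: the existence/uniqueness of `ψ` and the
independence of `μ^log` from `ψ` (any two `ψ` differ by an isometric reindexing; `HaarTransport.lean`
supplies the transport lemma), volumes of `log_p(R_I^×)`, any judgement on [IUTchIII] Cor. 3.12.
-/

noncomputable section

open MeasureTheory Set Metric
open scoped TensorProduct NormedField Pointwise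

namespace Literature.IUT.LogVolume

open Literature.NumberTheory.GaloisRepresentations.Ultrametric

variable (p : ℕ) [Fact p.Prime]
variable {I : Type} [Fintype I] [DecidableEq I]
variable (k : I → Type) [∀ i, NontriviallyNormedField (k i)] [∀ i, NormedAlgebra ℚ_[p] (k i)]
variable {J : Type} [Fintype J] (L : J → Type) [∀ j, NontriviallyNormedField (L j)]
  [∀ j, NormedAlgebra ℚ_[p] (L j)]

/-! ## Pure tensors and the decomposition `ψ` -/

/-- `⊗_i x_i = ∏_i ι_i(x_i)` in the commutative algebra `V`. [claim: Mochizuki2012, status: disputed] -/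
private theorem purePacket_eq_prod_iota (x : Π i, k i) :
    purePacket p k x = ∏ i, iota p k i (x i) := by
  have h : ∏ i, iota p k i (x i) = ∏ i, PiTensorProduct.tprodMonoidHom ℚ_[p] (Pi.mulSingle i (x i)) := by
    refine Finset.prod_congr rfl fun i _ ↦ ?_
    rfl
  rw [h, ← map_prod, Finset.univ_prod_mulSingle]
  rfl

variable (ψ : PacketAlgebra p k ≃ₐ[ℚ_[p]] (Π j, L j))

omit [Fintype I] [Fintype J] in
/-- The `(i, j)` component embedding `σ_{ij} : k_i → L_j`, `x ↦ ψ(ι_i(x))_j`, a `ℚ_p`-algebra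
homomorphism of fields (hence an isometry, `norm_map_algHom`). [claim: Mochizuki2012, status: disputed] -/
def factorEmb (i : I) (j : J) : k i →ₐ[ℚ_[p]] L j :=
  (Pi.evalAlgHom ℚ_[p] L j).comp ((ψ : PacketAlgebra p k →ₐ[ℚ_[p]] (Π j, L j)).comp (iota p k i))

omit [Fintype I] [Fintype J] in
/-- Unfolding `σ_{ij}(x) = ψ(ι_i x)_j`. [claim: Mochizuki2012, status: disputed] -/
theorem factorEmb_apply (i : I) (j : J) (x : k i) : factorEmb p k L ψ i j x = ψ (iota p k i x) j := rfl

omit [Fintype I] [Fintype J] in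
/-- **`σ_{ij}` is an isometry**: `‖ψ(ι_i x)_j‖ = ‖x‖`. [cite: NeukirchANT1999, Ch. II Thm. (4.8)] -/
theorem norm_factorEmb [∀ i, ProperSpace (k i)] (i : I) (j : J) (x : k i) :
    ‖factorEmb p k L ψ i j x‖ = ‖x‖ :=
  norm_map_algHom _ x

omit [Fintype J] in
/-- Components of the image of a pure tensor: `ψ(⊗_i h_i)_j = ∏_i σ_{ij}(h_i)`.
[claim: Mochizuki2012, status: disputed] -/
theorem psi_purePacket_apply (h : Π i, k i) (j : J) :
    ψ (purePacket p k h) j = ∏ i, factorEmb p k L ψ i j (h i) := by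
  rw [purePacket_eq_prod_iota, map_prod, Finset.prod_apply]
  rfl

omit [Fintype I] [DecidableEq I] [Fintype J] in
/-- Components of `ψ(p^n)`: `ψ(p^n)_j = p^n ∈ L_j`. [claim: Mochizuki2012, status: disputed] -/
theorem psi_ppow_apply (n : ℤ) (j : J) : ψ (ppow p k n) j = (p : L j) ^ n := by
  rw [ppow, AlgEquiv.commutes, Pi.algebraMap_apply, map_zpow₀, map_natCast]

omit [Fintype I] [DecidableEq I] [Fintype J] in
/-- `‖ψ(p^n)_j‖ = p^{−n}`. [claim: Mochizuki2012, status: disputed] -/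
theorem norm_psi_ppow_apply (n : ℤ) (j : J) : ‖ψ (ppow p k n) j‖ = (p : ℝ) ^ (-n) := by
  rw [psi_ppow_apply, norm_zpow, norm_prime p (L j), inv_zpow', ]

/-! ## `(R_I)^∼` is the set of `ℤ_p`-integral elements; `ψ((R_I)^∼) = ∏ O_{L_j}` -/

section Integral

variable [∀ i, IsUltrametricDist (k i)] [∀ i, ProperSpace (k i)] [Nonempty I]

omit [Nonempty I] in
/-- `R_I` consists of `ℤ_p`-integral elements: it is generated by the pure tensors `⊗ x_i`, `‖x_i‖ ≤ 1`,
and each `ι_i(x_i)` is integral (`‖x_i‖ ≤ 1 ↔ x_i` integral over `ℤ_p`).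
[claim: Mochizuki2012, status: disputed] -/
private theorem isIntegral_of_mem_integerPacket {x : PacketAlgebra p k} (hx : x ∈ integerPacket p k) :
    IsIntegral ℤ_[p] x := by
  have hle : integerPacket p k ≤ (integralClosure ℤ_[p] (PacketAlgebra p k)).toSubring := by
    rw [integerPacket, Subring.closure_le]
    rintro _ ⟨y, hy, rfl⟩
    change purePacket p k y ∈ integralClosure ℤ_[p] (PacketAlgebra p k)
    rw [purePacket_eq_prod_iota]
    refine prod_mem fun i _ ↦ ?_
    exact ((norm_le_one_iff_isIntegral p (k i) (y i)).mp (hy i)).map (iota p k i)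
  exact hle hx

omit [Fintype I] [∀ i, IsUltrametricDist (k i)] [∀ i, ProperSpace (k i)] in
/-- `ℤ_p ⊆ R_I`: the structure map `ℤ_p → V` lands in `R_I` (`r ↦ ⊗(r, 1, …, 1)`; `I ≠ ∅`).
[claim: Mochizuki2012, status: disputed] -/
private theorem algebraMap_mem_integerPacket (r : ℤ_[p]) :
    algebraMap ℤ_[p] (PacketAlgebra p k) r ∈ integerPacket p k := by
  obtain ⟨i₀⟩ := ‹Nonempty I›
  rw [PiTensorProduct.algebraMap_apply r i₀]
  refine Subring.subset_closure ⟨Pi.mulSingle i₀ (algebraMap ℤ_[p] (k i₀) r), fun i ↦ ?_, rfl⟩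
  by_cases hi : i = i₀
  · subst hi
    rw [Pi.mulSingle_eq_same, algebraMap_padicInt_apply, norm_algebraMap']
    exact r.2
  · rw [Pi.mulSingle_eq_of_ne hi, norm_one]

/-- **`x ∈ (R_I)^∼ ↔ x` is integral over `ℤ_p`** (`(R_I)^∼` = the integral closure of `R_I` in `V`, and
`R_I` is integral over `ℤ_p ⊆ R_I`). [claim: Mochizuki2012, status: disputed] -/
private theorem mem_normalizedPacket_iff_isIntegral (x : PacketAlgebra p k) :
    x ∈ normalizedPacket p k ↔ IsIntegral ℤ_[p] x := by
  set C := integralClosure ℤ_[p] (PacketAlgebra p k) with hC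
  have hle : integerPacket p k ≤ C.toSubring := fun y hy ↦
    isIntegral_of_mem_integerPacket p k hy
  constructor
  · intro hx
    -- `x` is integral over `R_I`, hence over the integral closure `C ⊇ R_I`, hence lies in `C`
    have hx' : IsIntegral (integerPacket p k) x := hx
    obtain ⟨P, hPm, hPx⟩ := hx'
    let incl : integerPacket p k →+* C := (Subring.inclusion hle)
    have hxC : IsIntegral C x := by
      refine ⟨P.map incl, hPm.map _, ?_⟩
      rw [Polynomial.eval₂_map]
      exact hPx
    have hmem : x ∈ integralClosure C (PacketAlgebra p k) := hxC
    rw [integralClosure_idem, Algebra.mem_bot] at hmem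
    obtain ⟨y, rfl⟩ := hmem
    exact y.2
  · rintro ⟨P, hPm, hPx⟩
    -- a monic relation over `ℤ_p` is one over `R_I ⊇ ℤ_p`
    let φ : ℤ_[p] →+* integerPacket p k :=
      (algebraMap ℤ_[p] (PacketAlgebra p k)).codRestrict _ (algebraMap_mem_integerPacket p k)
    change IsIntegral (integerPacket p k) x
    refine ⟨P.map φ, hPm.map _, ?_⟩
    rw [Polynomial.eval₂_map]
    exact hPx

/-- Integrality over `ℤ_p` in a finite product of algebras is componentwise. [folklore] -/
private theorem isIntegral_pi_iff {J' : Type} [Finite J'] {B : J' → Type} [∀ j, CommRing (B j)]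
    [∀ j, Algebra ℤ_[p] (B j)] (y : Π j, B j) :
    IsIntegral ℤ_[p] y ↔ ∀ j, IsIntegral ℤ_[p] (y j) := by
  classical
  haveI := Fintype.ofFinite J'
  constructor
  · intro hy j
    exact hy.map (Pi.evalAlgHom ℤ_[p] B j)
  · intro h
    choose P hP using h
    refine ⟨∏ j, P j, Polynomial.monic_prod_of_monic _ _ fun j _ ↦ (hP j).1, ?_⟩
    rw [← Polynomial.aeval_def]
    funext j
    have h1 : (Polynomial.aeval y (∏ j', P j')) j = Polynomial.aeval (y j) (∏ j', P j') :=
      (Polynomial.aeval_algHom_apply (Pi.evalAlgHom ℤ_[p] B j) y (∏ j', P j')).symm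
    rw [h1, Pi.zero_apply, Polynomial.aeval_def, Polynomial.eval₂_finsetProd]
    exact Finset.prod_eq_zero (Finset.mem_univ j) (hP j).2

omit [Fintype J] in
/-- **`ψ((R_I)^∼) = ∏_j O_{L_j}`** (the unit polydisc of `⊕_j L_j`): `ψ` preserves `ℤ_p`-integrality,
which is componentwise, and `O_{L_j}` is the set of `ℤ_p`-integral elements of `L_j`.
[cite: Mochizuki2012, IUTchIV Prop. 1.4 (i) p. 13] -/
theorem image_normalizedPacket [Finite J] [∀ j, IsUltrametricDist (L j)] [∀ j, ProperSpace (L j)] :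
    ψ '' (normalizedPacket p k : Set (PacketAlgebra p k)) = polydisc L (fun _ ↦ 1) := by
  ext y
  rw [mem_polydisc]
  constructor
  · rintro ⟨x, hx, rfl⟩ j
    rw [norm_le_one_iff_isIntegral p (L j)]
    have hxI := (mem_normalizedPacket_iff_isIntegral p k x).mp hx
    exact (isIntegral_pi_iff p (ψ x)).mp (hxI.map (ψ : PacketAlgebra p k →ₐ[ℚ_[p]] (Π j, L j))) j
  · intro hy
    refine ⟨ψ.symm y, ?_, ψ.apply_symm_apply y⟩
    rw [SetLike.mem_coe, mem_normalizedPacket_iff_isIntegral]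
    have hyI : IsIntegral ℤ_[p] y :=
      (isIntegral_pi_iff p y).mpr fun j ↦ (norm_le_one_iff_isIntegral p (L j) (y j)).mp (hy j)
    exact hyI.map (ψ.symm : (Π j, L j) →ₐ[ℚ_[p]] PacketAlgebra p k)

end Integral

/-! ## The log-volume `μ^log` on `V` and its normalisations -/

section Volume

variable [∀ j, IsUltrametricDist (L j)] [∀ j, ProperSpace (L j)]

/-- **"the degree"** of the packet through the decomposition: `D := Σ_j e_j·f_j` (`= Σ_j [L_j : ℚ_p] =
dim_{ℚ_p} V` by `e·f = [L:ℚ_p]`, `FundamentalIdentity.lean`), the weight by which the log-volume is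
"normalized [i.e., by dividing by the degree]" ([IUTchIV] Prop. 1.4 (i), p. 13).
[cite: Mochizuki2012, IUTchIV Prop. 1.4 (i) p. 13] -/
def packetDegree : ℕ := ∑ j, absRamificationIdx p (L j) * residueDegree p (L j)

/-- `D ≥ 1` as soon as there is a factor. [cite: Mochizuki2012, IUTchIV Prop. 1.4 (i) p. 13] -/
theorem packetDegree_pos [Nonempty J] : 0 < packetDegree p L := by
  classical
  obtain ⟨j₀⟩ := ‹Nonempty J›
  have h1 : 1 ≤ absRamificationIdx p (L j₀) * residueDegree p (L j₀) :=
    Nat.one_le_iff_ne_zero.mpr (Nat.mul_ne_zero (absRamificationIdx_pos p (L j₀)).ne'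
      (residueDegree_pos p (L j₀)).ne')
  exact lt_of_lt_of_le (lt_of_lt_of_le Nat.one_pos h1)
    (Finset.single_le_sum (f := fun j ↦ absRamificationIdx p (L j) * residueDegree p (L j))
      (fun j _ ↦ Nat.zero_le _) (Finset.mem_univ j₀))

/-- `(1/D)·Σ_j e_j f_j = 1`. [cite: Mochizuki2012, IUTchIV Prop. 1.4 (i) p. 13] -/
theorem sum_weight_mul_degree [Nonempty J] :
    ∑ j, ((packetDegree p L : ℝ))⁻¹ * ((absRamificationIdx p (L j) : ℝ) * residueDegree p (L j)) = 1 := by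
  rw [← Finset.mul_sum]
  have hD : (packetDegree p L : ℝ) ≠ 0 := by exact_mod_cast (packetDegree_pos p L).ne'
  have : ∑ j, ((absRamificationIdx p (L j) : ℝ) * residueDegree p (L j)) = packetDegree p L := by
    simp [packetDegree]
  rw [this, inv_mul_cancel₀ hD]

variable [∀ j, MeasurableSpace (L j)] [∀ j, BorelSpace (L j)]

omit [Fintype I] [DecidableEq I] in
/-- **The log-volume `μ^log` on compact open subsets of `V = ⊗ k_i`** "by abuse of notation": the
weight-`D` normalised log-volume of `PacketVolume.lean` on `⊕_j L_j` (Haar measure normalised at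
`∏_j O_{L_j}`, log divided by the degree `D`) of the image under the decomposition `ψ`.
[cite: Mochizuki2012, IUTchIV Prop. 1.4 (i) p. 13] -/
def packetLogVolume (A : Set (PacketAlgebra p k)) : ℝ :=
  (piUnitBallStructure L).normalizedLogVolume (packetDegree p L) (ψ '' A)

omit [Fintype I] [DecidableEq I] in
/-- Unfolding the definition. [cite: Mochizuki2012, IUTchIV Prop. 1.4 (i) p. 13] -/
theorem packetLogVolume_def (A : Set (PacketAlgebra p k)) :
    packetLogVolume p k L ψ A
      = (piUnitBallStructure L).normalizedLogVolume (packetDegree p L) (ψ '' A) := rfl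

/-- **Normalisation `μ^log((R_I)^∼) = 0`** ([IUTchIV] Prop. 1.4 (i): "normalized so that
`μ^log((R_E)^∼) = 0`"), since `ψ((R_I)^∼) = ∏_j O_{L_j}`. [cite: Mochizuki2012, IUTchIV Prop. 1.4 (i) p. 13] -/
theorem packetLogVolume_normalizedPacket [Nonempty I] [∀ i, IsUltrametricDist (k i)]
    [∀ i, ProperSpace (k i)] :
    packetLogVolume p k L ψ (normalizedPacket p k) = 0 := by
  rw [packetLogVolume, image_normalizedPacket, ← coe_piUnitBallStructure]
  exact (piUnitBallStructure L).normalizedLogVolume_self _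

omit [Fintype I] [DecidableEq I] [Fintype J] [∀ j, IsUltrametricDist (L j)] [∀ j, ProperSpace (L j)]
  [∀ j, MeasurableSpace (L j)] [∀ j, BorelSpace (L j)] in
/-- `ψ(g·A) = ψ(g)·ψ(A)` (multiplicativity of `ψ`). [claim: Mochizuki2012, status: disputed] -/
private theorem image_smul_set (g : PacketAlgebra p k) (A : Set (PacketAlgebra p k)) :
    ψ '' (g • A) = (fun y ↦ ψ g * y) '' (ψ '' A) := by
  rw [← image_smul, image_image, image_image]
  refine image_congr fun a _ ↦ ?_
  rw [smul_eq_mul, map_mul]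

/-- **Log-volume of a multiplicative translate of `(R_I)^∼`**, factor by factor: for `g ∈ V` with all
components `ψ(g)_j ≠ 0`, `ψ(g·(R_I)^∼) = ∏_j ψ(g)_j·O_{L_j}` and
`μ^log(g·(R_I)^∼) = (1/D)·Σ_j e_j f_j·log ‖ψ(g)_j‖` ([AbsTopIII] Prop. 5.7 (i)(b) in each factor).
[cite: Mochizuki2012, IUTchIV Prop. 1.4 (iii) proof p. 14] -/
theorem packetLogVolume_smul_normalizedPacket [Nonempty I] [∀ i, IsUltrametricDist (k i)]
    [∀ i, ProperSpace (k i)] (g : PacketAlgebra p k) (hg : ∀ j, ψ g j ≠ 0) :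
    packetLogVolume p k L ψ (g • (normalizedPacket p k : Set (PacketAlgebra p k)))
      = ∑ j, ((packetDegree p L : ℝ))⁻¹ *
          (((absRamificationIdx p (L j) : ℝ) * residueDegree p (L j)) * Real.log ‖ψ g j‖) := by
  have himg : ψ '' (g • (normalizedPacket p k : Set (PacketAlgebra p k)))
      = Set.pi univ (fun j ↦ closedBall (0 : L j) ‖ψ g j‖) := by
    rw [image_smul_set, image_normalizedPacket, ← hullSet_eq_image_mul L (ψ g) hg]
    rfl
  rw [packetLogVolume, himg]
  have hreg := isDirectProductRegion_hullSet L (ψ g) hg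
  rw [show piUnitBallStructure L = IntegralStructure.pi (fun j ↦ unitBallStructure (L j)) from rfl,
    ← IntegralStructure.weightedLogVolume_const_eq_normalizedLogVolume _ (packetDegree p L) hreg]
  have hw := weightedLogVolume_hullSet L (fun _ ↦ ((packetDegree p L : ℝ))⁻¹)
    (fun j ↦ Units.mk0 (ψ g j) (hg j))
  simp only [Units.val_mk0] at hw
  rw [hw]
  refine Finset.sum_congr rfl fun j _ ↦ ?_
  rw [mulLogVolume_eq_mul_log_norm p (L j) (Units.mk0 (ψ g j) (hg j)), Units.val_mk0]

/-- **Normalisation `μ^log(p·(R_I)^∼) = −log(p)`** ([IUTchIV] Prop. 1.4 (i)): every factor contributes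
`e_j f_j·log ‖p‖ = −e_j f_j·log(p)`, and `Σ_j e_j f_j = D`.
[cite: Mochizuki2012, IUTchIV Prop. 1.4 (i) p. 13] -/
theorem packetLogVolume_natCast_smul_normalizedPacket [Nonempty I] [Nonempty J]
    [∀ i, IsUltrametricDist (k i)] [∀ i, ProperSpace (k i)] :
    packetLogVolume p k L ψ ((p : PacketAlgebra p k) • (normalizedPacket p k : Set (PacketAlgebra p k)))
      = -Real.log p := by
  have hp : ∀ j, ψ (p : PacketAlgebra p k) j = (p : L j) := fun j ↦ by rw [map_natCast]; rfl
  have hg : ∀ j, ψ (p : PacketAlgebra p k) j ≠ 0 := fun j ↦ by rw [hp j]; exact prime_ne_zero p (L j)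
  rw [packetLogVolume_smul_normalizedPacket p k L ψ _ hg]
  simp_rw [hp, norm_prime, Real.log_inv]
  have h := sum_weight_mul_degree p L
  calc ∑ j, ((packetDegree p L : ℝ))⁻¹ *
        (((absRamificationIdx p (L j) : ℝ) * residueDegree p (L j)) * -Real.log p)
      = -Real.log p * ∑ j, ((packetDegree p L : ℝ))⁻¹ *
          ((absRamificationIdx p (L j) : ℝ) * residueDegree p (L j)) := by
        rw [Finset.mul_sum]
        refine Finset.sum_congr rfl fun j _ ↦ ?_
        ring
    _ = -Real.log p := by rw [h, mul_one]

/-- **`μ^log(p^n·(⊗_i h_i)·(R_I)^∼) = −n·log(p) + Σ_i log ‖h_i‖`** for `h_i ∈ k_i^×`: the `j`-th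
component of `ψ(p^n·⊗h_i)` is `p^n·∏_i σ_{ij}(h_i)`, of norm `p^{−n}·∏_i ‖h_i‖` in EVERY factor (the
embeddings are isometries), and the weights sum to `1`.  This is the volume of the sets written
"`p^λ·(R_I)^∼`" in [IUTchIV] Props. 1.2–1.4 (`TensorPacketRing.lean` realises `p^λ` as such products).
[cite: Mochizuki2012, IUTchIV Prop. 1.4 (iii) proof p. 14] -/
theorem packetLogVolume_ppow_mul_purePacket_smul [Nonempty I] [Nonempty J]
    [∀ i, IsUltrametricDist (k i)] [∀ i, ProperSpace (k i)] (n : ℤ) (h : Π i, k i) (hh : ∀ i, h i ≠ 0) :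
    packetLogVolume p k L ψ
        ((ppow p k n * purePacket p k h) • (normalizedPacket p k : Set (PacketAlgebra p k)))
      = -(n * Real.log p) + ∑ i, Real.log ‖h i‖ := by
  have hp0 : (0 : ℝ) < p := by exact_mod_cast (Fact.out : p.Prime).pos
  have hcomp : ∀ j, ψ (ppow p k n * purePacket p k h) j
      = (p : L j) ^ n * ∏ i, factorEmb p k L ψ i j (h i) := fun j ↦ by
    rw [map_mul, Pi.mul_apply, psi_ppow_apply, psi_purePacket_apply]
  have hnorm : ∀ j, ‖ψ (ppow p k n * purePacket p k h) j‖ = (p : ℝ) ^ (-n) * ∏ i, ‖h i‖ := fun j ↦ by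
    rw [hcomp, norm_mul, norm_zpow, norm_prime p (L j), inv_zpow', norm_prod]
    congr 1
    exact Finset.prod_congr rfl fun i _ ↦ norm_factorEmb p k L ψ i j (h i)
  have hg : ∀ j, ψ (ppow p k n * purePacket p k h) j ≠ 0 := fun j ↦ by
    rw [← norm_pos_iff, hnorm]
    exact mul_pos (zpow_pos hp0 _) (Finset.prod_pos fun i _ ↦ norm_pos_iff.mpr (hh i))
  rw [packetLogVolume_smul_normalizedPacket p k L ψ _ hg]
  simp_rw [hnorm]
  have hlog : Real.log ((p : ℝ) ^ (-n) * ∏ i, ‖h i‖) = -(n * Real.log p) + ∑ i, Real.log ‖h i‖ := by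
    rw [Real.log_mul (zpow_pos hp0 _).ne' (Finset.prod_pos fun i _ ↦ norm_pos_iff.mpr (hh i)).ne',
      Real.log_zpow, Real.log_prod fun i _ ↦ (norm_pos_iff.mpr (hh i)).ne']
    push_cast
    ring
  rw [hlog]
  have hsum := sum_weight_mul_degree p L
  calc ∑ j, ((packetDegree p L : ℝ))⁻¹ * (((absRamificationIdx p (L j) : ℝ) * residueDegree p (L j))
          * (-(n * Real.log p) + ∑ i, Real.log ‖h i‖))
      = (-(n * Real.log p) + ∑ i, Real.log ‖h i‖) * ∑ j, ((packetDegree p L : ℝ))⁻¹ *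
          ((absRamificationIdx p (L j) : ℝ) * residueDegree p (L j)) := by
        rw [Finset.mul_sum]
        refine Finset.sum_congr rfl fun j _ ↦ ?_
        ring
    _ = -(n * Real.log p) + ∑ i, Real.log ‖h i‖ := by rw [hsum, mul_one]

end Volume

end Literature.IUT.LogVolume

end
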